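import Mathlib
import HarnessLib

/-!
# Route `KLProgramme`, crux K3 `KLRegimeTwoPointLimit` — the NORM PLUMBING of Lemma E.5a (improved integration constants):
# FKTr2 Lemma VI «configurations of seminorms ⇒ improved integration constants», the sector combinatorics of FKTo3 Prop. XII
# «three contractions», and the `‖·‖₁ ≤ (one-fixed-leg count)·‖·‖₃` dictionary line
# (cell gate-hubbard-kl, seat p1 = C1 `BetaSplit` lead, generation 4; HOME/p1/E5A-NOTE.md §1–§3; DECOMP App. E, Lemma E.5)

Lemma E.5 of the cell's crux decomposition (the non-ladder part of the scale-`j` four-legged increment gains a summable factor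
`𝔍_j`) is, by HOME/p1/E5-NOTE.md, Feldman–Knörrer–Trubowitz's overlapping-loop theorem [FKTr2, Thm. VI] instantiated at positive
temperature on Benfatto–Giuliani–Mastropietro's single-scale propagators and anisotropic sectors.  Its hypothesis is that the pair
of covariances `(C, D) = (g^{(j)}, g^{(<j)})` has IMPROVED INTEGRATION CONSTANTS `(𝔠, 𝔟, 𝔍)` for a pair of norm families
`(‖·‖, ‖·‖_impr)`.  In print this hypothesis is discharged in three purely book-keeping steps, which this file proves in the
abstract (real numbers, finite sector sets), so that the analytic content left for E.5a is exactly three estimates on BGM's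
propagators (sup bound, `L¹` bound, Gram bound) and one counting lemma (E5A-NOTE §2):

* §1 **FKTr2 Lemma VI** [FKTr2, Def./Lemma after (VI.1), «Configurations of norms with improved power counting», odd version]:
  if a configuration of seminorms `‖·‖₁, ‖·‖₃, …, ‖·‖_q` (`p = 2i+1`, `q = 2Q+1`) obeys the simple contraction estimate at levels
  `p₁ + p₂ = p + 1` and the triple contraction estimate at levels `p₁ + p₂ = p + 3`, then FOR EVERY weight `J > 0` the sums
  `‖f‖ = Σ_{i ≤ Q} J^{-i} ‖f‖_{2i+1}`, `‖f‖_impr = Σ_{i ≤ Q-1} J^{-i} ‖f‖_{2i+1}` obey the contraction bound with the same constant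
  (`weighted_contraction_le`) and the triple-contraction bound with the EXTRA FACTOR `J` (`weighted_triple_contraction_le`):
  the improvement exponent is free book-keeping — `J^{-i} = J · J^{-i₁} J^{-i₂}` when `i₁ + i₂ = i + 1`.
* §2 **FKTo3 Prop. XII «three contractions», its sector combinatorics** [FKTo3, Prop. XII.?, proof (XII) p. 8 of the TeX]:
  contracting three legs of `φ` with three legs of `φ'` through SECTOR-DIAGONAL lines (line kernels `K_i(s, t) ≥ 0` with bounded
  row sums — in print: `d((·,t),(·,t')) = 0` unless `t ∩ t' ≠ ∅`, times `sup|d|` resp. `‖c‖_{1,Σ}`) costs the inputs at levels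
  `q` and `p − q + 3`: the three contracted sectors of `φ'` are FIXED (sup) once those of `φ` are summed
  (`triple_contraction_sector_sum_le`).  No momentum-conservation count enters this step.
* §3 **The `d = 2` dictionary line** [FKTo3 remark after Def. XII of `N`; FKTf1 §I.8 (I.?) «‖v̂‖_{1,Σ} = O(1/𝔩)»]: for a kernel
  supported on momentum-conserving sector 4-tuples, `‖ψ‖_{1,Σ} ≤ M · ‖ψ‖_{3,Σ}` with `M` = the largest number, over a fixed first
  sector, of sector PAIRS `(s₂, s₃)` admitting a compatible fourth sector (`level_one_le_pairCount_mul_level_three`) — the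
  one-fixed-leg four-sector count of BGM 2006 Lemma 3.1 / the tree's `HubbardBandSectorCounting*` / `CountPairsOffset`; this is
  where the improvement factor acquires its value `𝔍_j ≍ |Σ_j|⁻¹ ≍ γ^{j/2}` (E5A-NOTE §2: for ANISOTROPIC sectors the Cooper
  logarithm is additive, not multiplicative).

All statements are finite sums over real numbers; the position-space `L¹–L^∞` norms of the sources are abstracted into the
nonnegative sector functions (`φ s₁ s₂ s₃ a b` stands for `‖φ((·,s₁),(·,s₂),(·,s₃),(·,a),(·,b))‖_{1,∞}`).

References.  [FKTr2] J. Feldman, H. Knörrer, E. Trubowitz, *Convergence of perturbation expansions in fermionic models. Part 2: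
Overlapping loops*, Commun. Math. Phys. 247 (2004) 243–319, arXiv:math-ph/0209046, §VI.  [FKTo3] J. Feldman, H. Knörrer,
E. Trubowitz, *Single scale analysis of many fermion systems. Part 3: Sectorized norms*, Rev. Math. Phys. 15 (2003) 1121–1169,
arXiv:math-ph/0209042, §XII, §XV.  [FKTf1] J. Feldman, H. Knörrer, E. Trubowitz, *A two dimensional Fermi liquid. Part 1:
Overview*, Commun. Math. Phys. 247 (2004) 1–47, arXiv:math-ph/0209047, §I.8.  G. Benfatto, A. Giuliani, V. Mastropietro,
Ann. Henri Poincaré 7 (2006) 809–898 = arXiv:cond-mat/0507686, Lemma 3.1, (2.71a).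
-/

noncomputable section

namespace Summit.HubbardSuperconductivity.HubbardSuperconductivity.Theorems.SectorisedNormConfiguration

set_option linter.dupNamespace false -- summit = problem name (single-conjunct summit), D-0017

open Finset

/-! ### §1  FKTr2 Lemma VI — configurations of seminorms give improved integration constants for every weight `J > 0` -/

/-- The weight identity behind the improvement: for `J ≠ 0`, `(J^{i₁+i₂})⁻¹ = (J^{i₁})⁻¹ (J^{i₂})⁻¹`. [folklore] -/
theorem inv_pow_add_eq (J : ℝ) (i₁ i₂ : ℕ) : (J ^ (i₁ + i₂))⁻¹ = (J ^ i₁)⁻¹ * (J ^ i₂)⁻¹ := by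
  rw [pow_add, mul_inv]

/-- **FKTr2 Lemma VI, simple contraction** [cite: FeldmanKnorrerTrubowitz2004OverlappingLoops, §VI Lemma «configurations», first
display of its proof].  Levels are indexed by `i` (`p = 2i + 1`), `q = 2Q + 1`.  If the configuration estimate
`a_i ≤ c Σ_{i₁+i₂ = i} x_{i₁} y_{i₂}` holds for every `i ≤ Q` (`a_i = ‖Cont_C(f ⊗ f')‖_{2i+1}`, `x = ‖f‖_•`, `y = ‖f'‖_•`,
`c = 𝔠`), then the weighted norms `Σ_{i ≤ Q} J^{-i}(·)_i` satisfy `‖Cont_C(f⊗f')‖ ≤ 𝔠 ‖f‖ ‖f'‖` for EVERY `J > 0`. -/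
theorem weighted_contraction_le {J c : ℝ} (hJ : 0 < J) (hc : 0 ≤ c) (Q : ℕ) {a x y : ℕ → ℝ}
    (hx : ∀ i, 0 ≤ x i) (hy : ∀ i, 0 ≤ y i)
    (h : ∀ i ∈ range (Q + 1),
      a i ≤ c * ∑ p ∈ range (Q + 1) ×ˢ range (Q + 1), if p.1 + p.2 = i then x p.1 * y p.2 else 0) :
    ∑ i ∈ range (Q + 1), (J ^ i)⁻¹ * a i
      ≤ c * (∑ i ∈ range (Q + 1), (J ^ i)⁻¹ * x i) * (∑ i ∈ range (Q + 1), (J ^ i)⁻¹ * y i) := by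
  have hJi : ∀ i : ℕ, 0 ≤ (J ^ i)⁻¹ := fun i => by positivity
  -- step 1: insert the hypothesis
  have step1 : ∑ i ∈ range (Q + 1), (J ^ i)⁻¹ * a i
      ≤ ∑ i ∈ range (Q + 1), (J ^ i)⁻¹ *
          (c * ∑ p ∈ range (Q + 1) ×ˢ range (Q + 1), if p.1 + p.2 = i then x p.1 * y p.2 else 0) :=
    sum_le_sum fun i hi => mul_le_mul_of_nonneg_left (h i hi) (hJi i)
  -- step 2: exchange the sums and evaluate the `i`-sum on the single level `i = p.1 + p.2`
  have step2 : ∑ i ∈ range (Q + 1), (J ^ i)⁻¹ *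
          (c * ∑ p ∈ range (Q + 1) ×ˢ range (Q + 1), if p.1 + p.2 = i then x p.1 * y p.2 else 0)
      = c * ∑ p ∈ range (Q + 1) ×ˢ range (Q + 1),
          if p.1 + p.2 ∈ range (Q + 1) then (J ^ (p.1 + p.2))⁻¹ * (x p.1 * y p.2) else 0 := by
    have : ∀ i ∈ range (Q + 1), (J ^ i)⁻¹ *
          (c * ∑ p ∈ range (Q + 1) ×ˢ range (Q + 1), if p.1 + p.2 = i then x p.1 * y p.2 else 0)
        = c * ∑ p ∈ range (Q + 1) ×ˢ range (Q + 1),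
            (if p.1 + p.2 = i then (J ^ i)⁻¹ * (x p.1 * y p.2) else 0) := by
      intro i _
      rw [mul_sum, mul_sum, mul_sum]
      refine sum_congr rfl fun p _ => ?_
      split_ifs <;> ring
    rw [sum_congr rfl this, ← mul_sum, sum_comm]
    congr 1
    refine sum_congr rfl fun p _ => ?_
    rw [sum_ite_eq]
  -- step 3: drop the level restriction and factorise the weights
  have step3 : ∑ p ∈ range (Q + 1) ×ˢ range (Q + 1),
          (if p.1 + p.2 ∈ range (Q + 1) then (J ^ (p.1 + p.2))⁻¹ * (x p.1 * y p.2) else 0)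
      ≤ ∑ p ∈ range (Q + 1) ×ˢ range (Q + 1), ((J ^ p.1)⁻¹ * x p.1) * ((J ^ p.2)⁻¹ * y p.2) := by
    refine sum_le_sum fun p _ => ?_
    split_ifs
    · rw [inv_pow_add_eq]
      have := hx p.1; have := hy p.2; have := hJi p.1; have := hJi p.2
      nlinarith [mul_nonneg (mul_nonneg (hJi p.1) (hx p.1)) (mul_nonneg (hJi p.2) (hy p.2))]
    · exact mul_nonneg (mul_nonneg (hJi _) (hx _)) (mul_nonneg (hJi _) (hy _))
  have step4 : ∑ p ∈ range (Q + 1) ×ˢ range (Q + 1), ((J ^ p.1)⁻¹ * x p.1) * ((J ^ p.2)⁻¹ * y p.2)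
      = (∑ i ∈ range (Q + 1), (J ^ i)⁻¹ * x i) * (∑ i ∈ range (Q + 1), (J ^ i)⁻¹ * y i) := by
    rw [sum_mul_sum, sum_product]
  calc ∑ i ∈ range (Q + 1), (J ^ i)⁻¹ * a i
      ≤ _ := step1
    _ = _ := step2
    _ ≤ c * ∑ p ∈ range (Q + 1) ×ˢ range (Q + 1), ((J ^ p.1)⁻¹ * x p.1) * ((J ^ p.2)⁻¹ * y p.2) :=
        mul_le_mul_of_nonneg_left step3 hc
    _ = _ := by rw [step4, mul_assoc]

/-- **FKTr2 Lemma VI, triple contraction = the improvement** [cite: FeldmanKnorrerTrubowitz2004OverlappingLoops, §VI Lemma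
«configurations», second display of its proof].  If the configuration's triple-contraction estimate
`a_i ≤ c Σ_{i₁+i₂ = i+1} x_{i₁} y_{i₂}` holds for every `i ≤ Q − 1` (levels `p₁ + p₂ = p + 3`, `p ≤ q − 2`;
`a_i = ‖Cont_{C}Cont_{C₂}Cont_{C₃}(f⊗f')‖_{2i+1}`, `c = 𝔟⁴𝔠`), then for EVERY `J > 0` the improved weighted norm
`Σ_{i ≤ Q−1} J^{-i} a_i` is bounded by `J · c · ‖f‖ ‖f'‖`: the improvement factor `𝔍 = J` is produced by the weights alone. -/
theorem weighted_triple_contraction_le {J c : ℝ} (hJ : 0 < J) (hc : 0 ≤ c) (Q : ℕ) {a x y : ℕ → ℝ}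
    (hx : ∀ i, 0 ≤ x i) (hy : ∀ i, 0 ≤ y i)
    (h : ∀ i ∈ range Q,
      a i ≤ c * ∑ p ∈ range (Q + 1) ×ˢ range (Q + 1), if p.1 + p.2 = i + 1 then x p.1 * y p.2 else 0) :
    ∑ i ∈ range Q, (J ^ i)⁻¹ * a i
      ≤ J * c * (∑ i ∈ range (Q + 1), (J ^ i)⁻¹ * x i) * (∑ i ∈ range (Q + 1), (J ^ i)⁻¹ * y i) := by
  have hJi : ∀ i : ℕ, 0 ≤ (J ^ i)⁻¹ := fun i => by positivity
  have hJ0 : J ≠ 0 := hJ.ne'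
  have step1 : ∑ i ∈ range Q, (J ^ i)⁻¹ * a i
      ≤ ∑ i ∈ range Q, (J ^ i)⁻¹ *
          (c * ∑ p ∈ range (Q + 1) ×ˢ range (Q + 1), if p.1 + p.2 = i + 1 then x p.1 * y p.2 else 0) :=
    sum_le_sum fun i hi => mul_le_mul_of_nonneg_left (h i hi) (hJi i)
  have step2 : ∑ i ∈ range Q, (J ^ i)⁻¹ *
          (c * ∑ p ∈ range (Q + 1) ×ˢ range (Q + 1), if p.1 + p.2 = i + 1 then x p.1 * y p.2 else 0)
      = c * ∑ p ∈ range (Q + 1) ×ˢ range (Q + 1),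
          ∑ i ∈ range Q, (if p.1 + p.2 = i + 1 then (J ^ i)⁻¹ * (x p.1 * y p.2) else 0) := by
    have : ∀ i ∈ range Q, (J ^ i)⁻¹ *
          (c * ∑ p ∈ range (Q + 1) ×ˢ range (Q + 1), if p.1 + p.2 = i + 1 then x p.1 * y p.2 else 0)
        = c * ∑ p ∈ range (Q + 1) ×ˢ range (Q + 1),
            (if p.1 + p.2 = i + 1 then (J ^ i)⁻¹ * (x p.1 * y p.2) else 0) := by
      intro i _
      rw [mul_sum, mul_sum, mul_sum]
      refine sum_congr rfl fun p _ => ?_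
      split_ifs <;> ring
    rw [sum_congr rfl this, ← mul_sum, sum_comm]
  -- the `i`-sum has at most one nonzero term, `i + 1 = p.1 + p.2`, where `J^{-i} = J · J^{-(p.1+p.2)}`
  have step3 : ∀ p : ℕ × ℕ,
      ∑ i ∈ range Q, (if p.1 + p.2 = i + 1 then (J ^ i)⁻¹ * (x p.1 * y p.2) else 0)
        ≤ J * (((J ^ p.1)⁻¹ * x p.1) * ((J ^ p.2)⁻¹ * y p.2)) := by
    intro p
    have hnn : 0 ≤ J * (((J ^ p.1)⁻¹ * x p.1) * ((J ^ p.2)⁻¹ * y p.2)) :=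
      mul_nonneg hJ.le (mul_nonneg (mul_nonneg (hJi _) (hx _)) (mul_nonneg (hJi _) (hy _)))
    rcases Nat.eq_zero_or_eq_succ_pred (p.1 + p.2) with h0 | hsucc
    · -- `p.1 + p.2 = 0`: no level `i` with `i + 1 = 0`
      have : ∀ i ∈ range Q, (if p.1 + p.2 = i + 1 then (J ^ i)⁻¹ * (x p.1 * y p.2) else 0) = 0 := by
        intro i _; rw [if_neg]; omega
      rw [sum_congr rfl this, sum_const_zero]; exact hnn
    · set n := (p.1 + p.2).pred with hn
      have hcond : ∀ i, (p.1 + p.2 = i + 1) ↔ (n = i) := by intro i; omega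
      have : ∀ i ∈ range Q, (if p.1 + p.2 = i + 1 then (J ^ i)⁻¹ * (x p.1 * y p.2) else 0)
          = (if n = i then (J ^ n)⁻¹ * (x p.1 * y p.2) else 0) := by
        intro i _
        by_cases hi : n = i
        · rw [if_pos ((hcond i).mpr hi), if_pos hi, hi]
        · rw [if_neg (fun h' => hi ((hcond i).mp h')), if_neg hi]
      rw [sum_congr rfl this, sum_ite_eq]
      split_ifs
      · -- `J^{-n} = J · J^{-(n+1)} = J · J^{-p.1} J^{-p.2}`
        have hw : (J ^ n)⁻¹ = J * ((J ^ p.1)⁻¹ * (J ^ p.2)⁻¹) := by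
          rw [← inv_pow_add_eq, hsucc, pow_succ, mul_inv, ← mul_assoc, mul_comm J, mul_assoc, mul_inv_cancel₀ hJ0,
            mul_one]
        rw [hw]; apply le_of_eq; ring
      · exact hnn
  have step4 : ∑ p ∈ range (Q + 1) ×ˢ range (Q + 1), J * (((J ^ p.1)⁻¹ * x p.1) * ((J ^ p.2)⁻¹ * y p.2))
      = J * ((∑ i ∈ range (Q + 1), (J ^ i)⁻¹ * x i) * (∑ i ∈ range (Q + 1), (J ^ i)⁻¹ * y i)) := by
    rw [← mul_sum, sum_mul_sum, sum_product]
  calc ∑ i ∈ range Q, (J ^ i)⁻¹ * a i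
      ≤ _ := step1
    _ = _ := step2
    _ ≤ c * ∑ p ∈ range (Q + 1) ×ˢ range (Q + 1), J * (((J ^ p.1)⁻¹ * x p.1) * ((J ^ p.2)⁻¹ * y p.2)) :=
        mul_le_mul_of_nonneg_left (sum_le_sum fun p _ => step3 p) hc
    _ = _ := by rw [step4]; ring

/-- **The improved norm is dominated by the full norm** (`‖·‖_impr ≤ ‖·‖`, FKTr2 §VI: «Clearly»): dropping the top level. -/
theorem weighted_impr_le_weighted {J : ℝ} (hJ : 0 < J) (Q : ℕ) {x : ℕ → ℝ} (hx : ∀ i, 0 ≤ x i) :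
    ∑ i ∈ range Q, (J ^ i)⁻¹ * x i ≤ ∑ i ∈ range (Q + 1), (J ^ i)⁻¹ * x i :=
  sum_le_sum_of_subset_of_nonneg (range_mono (Nat.le_succ Q)) fun i _ _ => by
    have := hx i; positivity

/-! ### §2  FKTo3 Prop. XII «three contractions» — the sector combinatorics

Two sectorised kernels `φ` (legs: three contracted ones with sectors `s₁ s₂ s₃`, fixed external legs `a`, summed external
legs `b`) and `φ'` (contracted `t₁ t₂ t₃`, fixed `a'`, summed `b'`) are joined by three lines with nonnegative sector kernels
`K₁ K₂ K₃` (in print: `sup|d|·1[t ∩ t' ≠ ∅]`, `sup|d'|·1[…]`, and the `L¹` kernel of `c`).  The contracted object, at the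
external sector assignment `(a, a', b, b')`, is (after the position-space `L¹–L^∞` bounds of [FKTo3, Lemma II.? / Cor.])
bounded by `γ a a' b b' = Σ φ(s,a,b) K₁(s₁,t₁) K₂(s₂,t₂) K₃(s₃,t₃) φ'(t,a',b')`. -/

section Triple

variable {S α α' β β' : Type*} [Fintype S] [Fintype β] [Fintype β']

/-- **FKTo3 Prop. XII, the sector sums — nested form** [cite: FeldmanKnorrerTrubowitz2003SectorizedNorms, Prop. XII «three
contractions», display (XII) «≤ const 𝔩²/M^{2j} ‖φ‖_{q,Σ} ‖φ''‖_{p−q+3,Σ}»]: if every line kernel has row sums `Σ_t K_i(s,t) ≤ k_i`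
(sector diagonality: at most three `t` per `s`, times the sup resp. `L¹` size of the line) and `φ'` is bounded at the level where
its three contracted sectors AND its fixed external sectors are held fixed (`Σ_{b'} φ'(t₁,t₂,t₃,a',b') ≤ Y` for all `t`), then
summing the contracted object over the free external sectors costs `φ` only at the level where its contracted sectors are SUMMED:
`Σ_{b,s} φ(s,a,b) Σ_{t₁} K₁ Σ_{t₂} K₂ Σ_{t₃} K₃ Σ_{b'} φ' ≤ k₁ k₂ k₃ · (Σ_{s,b} φ(s,a,b)) · Y`.  No momentum-conservation count
is used. -/
theorem triple_contraction_sector_sum_le_nested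
    (φ : S → S → S → α → β → ℝ) (φ' : S → S → S → α' → β' → ℝ) (K₁ K₂ K₃ : S → S → ℝ)
    (hφ : ∀ s₁ s₂ s₃ a b, 0 ≤ φ s₁ s₂ s₃ a b) (hφ' : ∀ t₁ t₂ t₃ a' b', 0 ≤ φ' t₁ t₂ t₃ a' b')
    (hK₁ : ∀ s t, 0 ≤ K₁ s t) (hK₂ : ∀ s t, 0 ≤ K₂ s t) (hK₃ : ∀ s t, 0 ≤ K₃ s t)
    {k₁ k₂ k₃ : ℝ} (hk₁ : ∀ s, ∑ t, K₁ s t ≤ k₁) (hk₂ : ∀ s, ∑ t, K₂ s t ≤ k₂) (hk₃ : ∀ s, ∑ t, K₃ s t ≤ k₃)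
    (a : α) (a' : α') {Y : ℝ} (hY : ∀ t₁ t₂ t₃, ∑ b', φ' t₁ t₂ t₃ a' b' ≤ Y) :
    ∑ b, ∑ s₁, ∑ s₂, ∑ s₃, φ s₁ s₂ s₃ a b *
        ∑ t₁, K₁ s₁ t₁ * ∑ t₂, K₂ s₂ t₂ * ∑ t₃, K₃ s₃ t₃ * ∑ b', φ' t₁ t₂ t₃ a' b'
      ≤ k₁ * k₂ * k₃ * (∑ b, ∑ s₁, ∑ s₂, ∑ s₃, φ s₁ s₂ s₃ a b) * Y := by
  -- `Y ≥ 0` and `k_i ≥ 0` as soon as a sector exists (inside the sums one does)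
  have hYnn : S → 0 ≤ Y := fun s => le_trans (sum_nonneg fun b' _ => hφ' s s s a' b') (hY s s s)
  have hk₃nn : S → 0 ≤ k₃ := fun s => le_trans (sum_nonneg fun t _ => hK₃ s t) (hk₃ s)
  have hk₂nn : S → 0 ≤ k₂ := fun s => le_trans (sum_nonneg fun t _ => hK₂ s t) (hk₂ s)
  -- innermost line
  have inner₃ : ∀ s₃ t₁ t₂, ∑ t₃, K₃ s₃ t₃ * ∑ b', φ' t₁ t₂ t₃ a' b' ≤ k₃ * Y := by
    intro s₃ t₁ t₂
    calc ∑ t₃, K₃ s₃ t₃ * ∑ b', φ' t₁ t₂ t₃ a' b'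
        ≤ ∑ t₃, K₃ s₃ t₃ * Y := sum_le_sum fun t₃ _ => mul_le_mul_of_nonneg_left (hY t₁ t₂ t₃) (hK₃ s₃ t₃)
      _ = (∑ t₃, K₃ s₃ t₃) * Y := by rw [sum_mul]
      _ ≤ k₃ * Y := mul_le_mul_of_nonneg_right (hk₃ s₃) (hYnn s₃)
  have inner₂ : ∀ s₂ s₃ t₁, ∑ t₂, K₂ s₂ t₂ * ∑ t₃, K₃ s₃ t₃ * ∑ b', φ' t₁ t₂ t₃ a' b' ≤ k₂ * (k₃ * Y) := by
    intro s₂ s₃ t₁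
    calc ∑ t₂, K₂ s₂ t₂ * ∑ t₃, K₃ s₃ t₃ * ∑ b', φ' t₁ t₂ t₃ a' b'
        ≤ ∑ t₂, K₂ s₂ t₂ * (k₃ * Y) := sum_le_sum fun t₂ _ => mul_le_mul_of_nonneg_left (inner₃ s₃ t₁ t₂) (hK₂ s₂ t₂)
      _ = (∑ t₂, K₂ s₂ t₂) * (k₃ * Y) := by rw [sum_mul]
      _ ≤ k₂ * (k₃ * Y) := mul_le_mul_of_nonneg_right (hk₂ s₂) (mul_nonneg (hk₃nn s₂) (hYnn s₂))
  have inner₁ : ∀ s₁ s₂ s₃,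
      ∑ t₁, K₁ s₁ t₁ * ∑ t₂, K₂ s₂ t₂ * ∑ t₃, K₃ s₃ t₃ * ∑ b', φ' t₁ t₂ t₃ a' b' ≤ k₁ * (k₂ * (k₃ * Y)) := by
    intro s₁ s₂ s₃
    calc ∑ t₁, K₁ s₁ t₁ * ∑ t₂, K₂ s₂ t₂ * ∑ t₃, K₃ s₃ t₃ * ∑ b', φ' t₁ t₂ t₃ a' b'
        ≤ ∑ t₁, K₁ s₁ t₁ * (k₂ * (k₃ * Y)) :=
          sum_le_sum fun t₁ _ => mul_le_mul_of_nonneg_left (inner₂ s₂ s₃ t₁) (hK₁ s₁ t₁)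
      _ = (∑ t₁, K₁ s₁ t₁) * (k₂ * (k₃ * Y)) := by rw [sum_mul]
      _ ≤ k₁ * (k₂ * (k₃ * Y)) :=
          mul_le_mul_of_nonneg_right (hk₁ s₁) (mul_nonneg (hk₂nn s₁) (mul_nonneg (hk₃nn s₁) (hYnn s₁)))
  calc ∑ b, ∑ s₁, ∑ s₂, ∑ s₃, φ s₁ s₂ s₃ a b *
          ∑ t₁, K₁ s₁ t₁ * ∑ t₂, K₂ s₂ t₂ * ∑ t₃, K₃ s₃ t₃ * ∑ b', φ' t₁ t₂ t₃ a' b'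
      ≤ ∑ b, ∑ s₁, ∑ s₂, ∑ s₃, φ s₁ s₂ s₃ a b * (k₁ * (k₂ * (k₃ * Y))) :=
        sum_le_sum fun b _ => sum_le_sum fun s₁ _ => sum_le_sum fun s₂ _ => sum_le_sum fun s₃ _ =>
          mul_le_mul_of_nonneg_left (inner₁ s₁ s₂ s₃) (hφ s₁ s₂ s₃ a b)
    _ = k₁ * k₂ * k₃ * (∑ b, ∑ s₁, ∑ s₂, ∑ s₃, φ s₁ s₂ s₃ a b) * Y := by
        simp only [← sum_mul]; ring

/-- **FKTo3 Prop. XII, the sector sums — flat form** [cite: FeldmanKnorrerTrubowitz2003SectorizedNorms, Prop. XII «three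
contractions»]: the eightfold sector sum of `φ(s,a,b) K₁(s₁,t₁) K₂(s₂,t₂) K₃(s₃,t₃) φ'(t,a',b')` over the three pairs of
contracted sectors and the free external sectors `b, b'` is at most `k₁ k₂ k₃ · ‖φ(·,a,·)‖₍contracted summed₎ · sup_t ‖φ'(t,a',·)‖`
— the output at level `p` (fixed externals `a, a'`) costs the inputs at levels `q = |a|` and `p − q + 3 = |a'| + 3`. -/
theorem triple_contraction_sector_sum_le
    (φ : S → S → S → α → β → ℝ) (φ' : S → S → S → α' → β' → ℝ) (K₁ K₂ K₃ : S → S → ℝ)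
    (hφ : ∀ s₁ s₂ s₃ a b, 0 ≤ φ s₁ s₂ s₃ a b) (hφ' : ∀ t₁ t₂ t₃ a' b', 0 ≤ φ' t₁ t₂ t₃ a' b')
    (hK₁ : ∀ s t, 0 ≤ K₁ s t) (hK₂ : ∀ s t, 0 ≤ K₂ s t) (hK₃ : ∀ s t, 0 ≤ K₃ s t)
    {k₁ k₂ k₃ : ℝ} (hk₁ : ∀ s, ∑ t, K₁ s t ≤ k₁) (hk₂ : ∀ s, ∑ t, K₂ s t ≤ k₂) (hk₃ : ∀ s, ∑ t, K₃ s t ≤ k₃)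
    (a : α) (a' : α') {Y : ℝ} (hY : ∀ t₁ t₂ t₃, ∑ b', φ' t₁ t₂ t₃ a' b' ≤ Y) :
    ∑ b, ∑ s₁, ∑ s₂, ∑ s₃, ∑ t₁, ∑ t₂, ∑ t₃, ∑ b',
        φ s₁ s₂ s₃ a b * K₁ s₁ t₁ * K₂ s₂ t₂ * K₃ s₃ t₃ * φ' t₁ t₂ t₃ a' b'
      ≤ k₁ * k₂ * k₃ * (∑ b, ∑ s₁, ∑ s₂, ∑ s₃, φ s₁ s₂ s₃ a b) * Y := by
  have h := triple_contraction_sector_sum_le_nested φ φ' K₁ K₂ K₃ hφ hφ' hK₁ hK₂ hK₃ hk₁ hk₂ hk₃ a a' hY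
  simpa only [mul_sum, mul_assoc] using h

end Triple

/-! ### §3  The `d = 2` dictionary line: `‖ψ‖_{1,Σ} ≤ (one-fixed-leg pair count) · ‖ψ‖_{3,Σ}`

For a four-legged sectorised kernel `ψ(s₁,s₂,s₃,s₄) ≥ 0` (standing for `‖ψ((·,s₁),…,(·,s₄))‖_{1,∞}`) SUPPORTED on a relation `R`
(momentum conservation modulo `2πℤ²` within the sector resolution: `ψ = 0` off `R`), the level-one norm `sup_{s₁} Σ_{s₂,s₃,s₄} ψ`
is at most the number `M` of sector pairs `(s₂, s₃)` compatible with a fixed `s₁` (for some fourth sector) times the level-three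
norm `sup_{s₁,s₂,s₃} Σ_{s₄} ψ`; and at most the number of compatible TRIPLES times the all-fixed (BGM (2.71a)) size.  This is the
only place where the sector-counting lemma of BGM 2006 Lemma 3.1 / App. F enters the improved-norm bookkeeping (E5A-NOTE §2). -/

section Dictionary

variable {S : Type*} [Fintype S]

/-- **`‖ψ‖₁ ≤ M · ‖ψ‖₃`** [cite: FeldmanKnorrerTrubowitz2004, §I.8 «‖v̂‖_{1,Σ} is of the order max_{s₁} #{(s₂,s₃,s₄)}»]:
with `M` the largest number, over `s₁`, of pairs `(s₂,s₃)` admitting some `s₄` with `R s₁ s₂ s₃ s₄`. -/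
theorem level_one_le_pairCount_mul_level_three (ψ : S → S → S → S → ℝ)
    (R : S → S → S → S → Prop) [∀ s₁ s₂ s₃ s₄, Decidable (R s₁ s₂ s₃ s₄)]
    (hsupp : ∀ s₁ s₂ s₃ s₄, ¬ R s₁ s₂ s₃ s₄ → ψ s₁ s₂ s₃ s₄ = 0)
    {M : ℕ} (hM : ∀ s₁, ((Finset.univ : Finset (S × S)).filter fun p => ∃ s₄, R s₁ p.1 p.2 s₄).card ≤ M)
    {X : ℝ} (hX0 : 0 ≤ X) (hX : ∀ s₁ s₂ s₃, ∑ s₄, ψ s₁ s₂ s₃ s₄ ≤ X) (s₁ : S) :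
    ∑ s₂, ∑ s₃, ∑ s₄, ψ s₁ s₂ s₃ s₄ ≤ M * X := by
  set P : Finset (S × S) := (Finset.univ : Finset (S × S)).filter fun p => ∃ s₄, R s₁ p.1 p.2 s₄ with hP
  have hflat : ∑ s₂, ∑ s₃, ∑ s₄, ψ s₁ s₂ s₃ s₄ = ∑ p : S × S, ∑ s₄, ψ s₁ p.1 p.2 s₄ :=
    (Fintype.sum_prod_type' (fun s₂ s₃ => ∑ s₄, ψ s₁ s₂ s₃ s₄)).symm
  rw [hflat, ← Finset.sum_filter_add_sum_filter_not Finset.univ (fun p : S × S => ∃ s₄, R s₁ p.1 p.2 s₄)]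
  have hzero : ∑ p ∈ Finset.univ.filter (fun p : S × S => ¬ ∃ s₄, R s₁ p.1 p.2 s₄), ∑ s₄, ψ s₁ p.1 p.2 s₄ = 0 := by
    refine sum_eq_zero fun p hp => sum_eq_zero fun s₄ _ => hsupp _ _ _ _ fun hR => ?_
    exact (Finset.mem_filter.mp hp).2 ⟨s₄, hR⟩
  rw [hzero, add_zero]
  calc ∑ p ∈ P, ∑ s₄, ψ s₁ p.1 p.2 s₄
      ≤ ∑ p ∈ P, X := sum_le_sum fun p _ => hX s₁ p.1 p.2
    _ = P.card * X := by rw [sum_const, nsmul_eq_mul]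
    _ ≤ M * X := mul_le_mul_of_nonneg_right (by exact_mod_cast hM s₁) hX0

/-- **`‖ψ‖₁ ≤ M₃ · sup ψ`** (the all-fixed level of BGM 2006 (2.71a)) [cite: BenfattoGiulianiMastropietro2006, Lemma 3.1 (3.23):
«the number of 4-ples … is bounded by cγ^{-h}|h|»]: with `M₃` the largest number, over `s₁`, of compatible triples `(s₂,s₃,s₄)`. -/
theorem level_one_le_tripleCount_mul_sup (ψ : S → S → S → S → ℝ)
    (R : S → S → S → S → Prop) [∀ s₁ s₂ s₃ s₄, Decidable (R s₁ s₂ s₃ s₄)]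
    (hsupp : ∀ s₁ s₂ s₃ s₄, ¬ R s₁ s₂ s₃ s₄ → ψ s₁ s₂ s₃ s₄ = 0)
    {M : ℕ} (hM : ∀ s₁, ((Finset.univ : Finset (S × S × S)).filter fun p => R s₁ p.1 p.2.1 p.2.2).card ≤ M)
    {X : ℝ} (hX0 : 0 ≤ X) (hX : ∀ s₁ s₂ s₃ s₄, ψ s₁ s₂ s₃ s₄ ≤ X) (s₁ : S) :
    ∑ s₂, ∑ s₃, ∑ s₄, ψ s₁ s₂ s₃ s₄ ≤ M * X := by
  set P : Finset (S × S × S) := (Finset.univ : Finset (S × S × S)).filter fun p => R s₁ p.1 p.2.1 p.2.2 with hP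
  have hflat : ∑ s₂, ∑ s₃, ∑ s₄, ψ s₁ s₂ s₃ s₄ = ∑ p : S × S × S, ψ s₁ p.1 p.2.1 p.2.2 := by
    rw [Fintype.sum_prod_type' (fun s₂ (q : S × S) => ψ s₁ s₂ q.1 q.2)]
    exact Fintype.sum_congr _ _ fun s₂ => (Fintype.sum_prod_type' (fun s₃ s₄ => ψ s₁ s₂ s₃ s₄)).symm
  rw [hflat, ← Finset.sum_filter_add_sum_filter_not Finset.univ (fun p : S × S × S => R s₁ p.1 p.2.1 p.2.2)]
  have hzero : ∑ p ∈ Finset.univ.filter (fun p : S × S × S => ¬ R s₁ p.1 p.2.1 p.2.2), ψ s₁ p.1 p.2.1 p.2.2 = 0 :=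
    sum_eq_zero fun p hp => hsupp _ _ _ _ (Finset.mem_filter.mp hp).2
  rw [hzero, add_zero]
  calc ∑ p ∈ P, ψ s₁ p.1 p.2.1 p.2.2
      ≤ ∑ p ∈ P, X := sum_le_sum fun p _ => hX s₁ p.1 p.2.1 p.2.2
    _ = P.card * X := by rw [sum_const, nsmul_eq_mul]
    _ ≤ M * X := mul_le_mul_of_nonneg_right (by exact_mod_cast hM s₁) hX0

end Dictionary

/-! ### §4  The exponent dictionary: BGM's external-sector exponents are FKT's three-level sector power counting (E5A-NOTE (E5a-4))

In FKT's scaled norm `N_j(w) = (M^{2j}/𝔩) Σ_n αⁿ(𝔩𝔅/M^j)^{n/2}[‖w_n‖₁ + 𝔩⁻¹‖w_n‖₃ + 𝔩⁻²‖w_n‖₅]` [FKTo3 Def. XV], read on BGM's anisotropic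
sectors (`M^{-j} ↦ γ^h`, `𝔩 ↦ γ^{h/2}`, `γ = 4`, `h ≤ 0`), the weight of a `2p`-legged kernel is `γ^{-2h}γ^{-h/2}γ^{(3h/2)p}` and BGM's
Theorem 2.1 / Lemma 2.5 [BGM 2006 (2.77), (2.98)] bound the three levels by `(c|U|)^{p-1}γ^{h(e_F - 3p/2)}` with `e₁ = 5/2`, `e₃ = 3`,
`e₅ = 7/2`.  The product is scale-free — every term of `N_h` is `O((c|U|)^{p-1})` UNIFORMLY in the scale `h`, which is the form in
which FKTr2's smallness hypothesis is used down to the Kohn–Luttinger scale (E5A-NOTE §0.4–0.5). -/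

section Exponents

/-- **BGM (2.77)/(2.98) exponents × FKT weights are scale-free** [cite: BenfattoGiulianiMastropietro2006, §2.8 (2.77) and Lemma 2.5 (2.98):
`e₁ = 5/2, e₃ = 3, e₅ = 7/2`]: for every `γ > 0`, scale `h` and leg number `2p`,
`γ^{-2h}·γ^{-h/2}·γ^{(3h/2)p}·(γ^{h(5/2-3p/2)} + γ^{-h/2}γ^{h(3-3p/2)} + γ^{-h}γ^{h(7/2-3p/2)}) = 3`. -/
theorem bgm_exponents_mul_fkt_weights_eq_three {γ : ℝ} (hγ : 0 < γ) (h p : ℝ) :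
    γ ^ (-2 * h) * γ ^ (-h / 2) * γ ^ (3 * h / 2 * p) *
        (γ ^ (h * (5 / 2 - 3 * p / 2)) + γ ^ (-h / 2) * γ ^ (h * (3 - 3 * p / 2)) +
          γ ^ (-h) * γ ^ (h * (7 / 2 - 3 * p / 2))) = 3 := by
  have e1 : γ ^ (-2 * h) * γ ^ (-h / 2) * γ ^ (3 * h / 2 * p) * γ ^ (h * (5 / 2 - 3 * p / 2)) = 1 := by
    simp only [← Real.rpow_add hγ]
    rw [show -2 * h + -h / 2 + 3 * h / 2 * p + h * (5 / 2 - 3 * p / 2) = 0 by ring, Real.rpow_zero]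
  have e2 : γ ^ (-2 * h) * γ ^ (-h / 2) * γ ^ (3 * h / 2 * p) * (γ ^ (-h / 2) * γ ^ (h * (3 - 3 * p / 2))) = 1 := by
    simp only [← Real.rpow_add hγ]
    rw [show -2 * h + -h / 2 + 3 * h / 2 * p + (-h / 2 + h * (3 - 3 * p / 2)) = 0 by ring, Real.rpow_zero]
  have e3 : γ ^ (-2 * h) * γ ^ (-h / 2) * γ ^ (3 * h / 2 * p) * (γ ^ (-h) * γ ^ (h * (7 / 2 - 3 * p / 2))) = 1 := by
    simp only [← Real.rpow_add hγ]
    rw [show -2 * h + -h / 2 + 3 * h / 2 * p + (-h + h * (7 / 2 - 3 * p / 2)) = 0 by ring, Real.rpow_zero]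
  calc γ ^ (-2 * h) * γ ^ (-h / 2) * γ ^ (3 * h / 2 * p) *
        (γ ^ (h * (5 / 2 - 3 * p / 2)) + γ ^ (-h / 2) * γ ^ (h * (3 - 3 * p / 2)) +
          γ ^ (-h) * γ ^ (h * (7 / 2 - 3 * p / 2)))
      = γ ^ (-2 * h) * γ ^ (-h / 2) * γ ^ (3 * h / 2 * p) * γ ^ (h * (5 / 2 - 3 * p / 2)) +
          γ ^ (-2 * h) * γ ^ (-h / 2) * γ ^ (3 * h / 2 * p) * (γ ^ (-h / 2) * γ ^ (h * (3 - 3 * p / 2))) +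
          γ ^ (-2 * h) * γ ^ (-h / 2) * γ ^ (3 * h / 2 * p) * (γ ^ (-h) * γ ^ (h * (7 / 2 - 3 * p / 2))) := by ring
    _ = 3 := by rw [e1, e2, e3]; norm_num

/-- **The level ratios alone** (Lemma 2.4's gains): `γ^{-h/2}·γ^{h(e₃ - e₁)} = 1` and `γ^{-h}·γ^{h(e₅ - e₁)} = 1` — three resp. five fixed
external sectors gain exactly one resp. two sector lengths `𝔩 = γ^{h/2}`, i.e. `‖·‖₁ : ‖·‖₃ : ‖·‖₅ = 1 : 𝔩 : 𝔩²` [cite: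
BenfattoGiulianiMastropietro2006, Lemma 2.4 / Lemma 2.5 (2.98)]. -/
theorem bgm_level_gains {γ : ℝ} (hγ : 0 < γ) (h : ℝ) :
    γ ^ (-h / 2) * γ ^ (h * (3 - 5 / 2)) = 1 ∧ γ ^ (-h) * γ ^ (h * (7 / 2 - 5 / 2)) = 1 := by
  constructor
  · rw [← Real.rpow_add hγ, show -h / 2 + h * (3 - 5 / 2) = 0 by ring, Real.rpow_zero]
  · rw [← Real.rpow_add hγ, show -h + h * (7 / 2 - 5 / 2) = 0 by ring, Real.rpow_zero]

end Exponents

end Summit.HubbardSuperconductivity.HubbardSuperconductivity.Theorems.SectorisedNormConfiguration
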